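import Summits.QuantumAdvantage.QuantumAdvantage.Theorems.SosSandwichHomogeneousPBAATExponent
import Summits.QuantumAdvantage.QuantumAdvantage.Theorems.SosSandwichHomogeneousPBAARefutation

/-!
# Route `SosSandwich`: the admissible exponent corner of the homogeneous rung is `(Var², T¹)`

For the TOP-HOMOGENEOUS members of the SOS sandwich class `K_T` (`p`, `1 − p` sums of squares of degree-`≤ T`
polynomials on the cube; Laplacian eigen-equation `Σᵢ (p − p∘flipᵢ) = 4T (p − E p)`), consider influence laws
with SEPARATE exponents,

  `(a, b)`-law:  `∃ C > 0`, every such `p` with `Var[p] > 0` has a variable with `Infᵢ[p] ≥ C · Var[p]^a / T^b`.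

The route's support item `HomogeneousPBAAT` (stmt-QuantumAdvantage-27399; re-typing target of the dead stub
`stub_homogeneousRung` of crux `PseudoBoundedAA`, stmt-QuantumAdvantage-15237) is the tied family `a = b = c`;
the refuted rung `HomogeneousPBAA` (stmt-QuantumAdvantage-15241) was `(2, 0)`; the cell's "EG-shaped" variant V2
is `(2, c)`. THIS FILE (`homogeneousRung_exponent_corner`): every admissible pair has

  `a ≥ 2`  (mean-square / Deutsch–Jozsa family of `SosSandwichHomogeneousPBAATExponent`: at the fixed order
            `T = 1`, `maxInf = (8/N)·Var → 0·Var`, `Var = 2(N−1)/N³ ≤ 1`), and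
  `b ≥ 1`  (iterated address family of `SosSandwichHomogeneousPBAARefutation`: `Var = 1/4` fixed while
            `maxInf = 1/T → 0`, `T = 2^{k+1}`).

So `(a, b) = (2, 1)` — "`maxInf ≥ C·Var²/T`", the V2 form with `c = 1` — is the unique strongest candidate law on
the homogeneous class, consistent with every family in the tree (address: `maxInf = 16·Var²/T` with equality;
mean-square: `maxInf = 4√2·(1 − 1/N)^{-1/2}·Var^{3/2} ≥ Var²`); for the tied item 27399 the strongest possibly-true
instance is `c = 2` (`homogeneousPBAAT_exponent_ge_two`). Corollary for the refuted rung: `(a, 0)` is inadmissible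
for every `a` (`homogeneousRung_degreeFree_inadmissible`, the `b = 0` edge; 15241 was `a = 2`).

No named facts. [cite: EscuderoGutierrez2023, Thm. 1.6, Cor. 1.7, Question 4.5] [cite: AaronsonAmbainis2014, Conj. 6]
[cite: ODonnell2014, §2.2–§2.3]
-/

set_option linter.dupNamespace false -- D-0017: single-problem summit ⇒ `QuantumAdvantage.QuantumAdvantage` by design

noncomputable section
namespace Summit.QuantumAdvantage.QuantumAdvantage.Theorems.SosSandwich

open Finset MvPolynomial Literature.Computability.QuantumComplexity

/-- **The exponent corner of the homogeneous rung.** If `C > 0` and `(a, b)` are such that every pseudo-bounded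
`p` of order `T ≥ 1` obeying the Laplacian eigen-equation of order `T` with `Var[p] > 0` has a variable with
`C·Var[p]^a/T^b ≤ Infᵢ[p]` (literal inline vocabulary of the route file), then `a ≥ 2` and `b ≥ 1`.
[cite: EscuderoGutierrez2023, Thm. 1.6, Cor. 1.7] [cite: AaronsonAmbainis2014, Conj. 6] -/
theorem homogeneousRung_exponent_corner (a b : ℕ) {C : ℝ} (hC : 0 < C)
    (h : ∀ (N T : ℕ) (p : MvPolynomial (Fin N) ℝ),
      let ev : MvPolynomial (Fin N) ℝ → (Fin N → Bool) → ℝ :=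
        fun f x => MvPolynomial.eval (fun k => if x k then (1 : ℝ) else 0) f
      let avg : ((Fin N → Bool) → ℝ) → ℝ := fun g => (∑ x : Fin N → Bool, g x) / (2 : ℝ) ^ N
      1 ≤ T →
      (∃ (m : ℕ) (q r : Fin m → MvPolynomial (Fin N) ℝ),
          (∀ j, (q j).totalDegree ≤ T ∧ (r j).totalDegree ≤ T) ∧
            ∀ x : Fin N → Bool, ev p x = ∑ j, ev (q j) x ^ 2 ∧ 1 - ev p x = ∑ j, ev (r j) x ^ 2) →
      (∀ x : Fin N → Bool, ∑ i : Fin N, (ev p x - ev p (Function.update x i (!x i))) =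
          4 * (T : ℝ) * (ev p x - avg (ev p))) →
      0 < (avg fun x => (ev p x - avg (ev p)) ^ 2) →
      ∃ i : Fin N, C * (avg fun x => (ev p x - avg (ev p)) ^ 2) ^ a / (T : ℝ) ^ b ≤
        (avg fun x => (ev p x - ev p (Function.update x i (!x i))) ^ 2)) :
    2 ≤ a ∧ 1 ≤ b := by
  constructor
  · -- `a ≥ 2`: the mean-square family at the fixed order `T = 1`
    by_contra ha
    push Not at ha
    obtain ⟨n, hn⟩ := exists_nat_gt (8 / C)
    obtain ⟨p, hPB, -, -, hLap, hInf, hVar⟩ := MeanSquare.exists_meanSquare (n + 2) (by omega)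
    have hN2 : (2 : ℝ) ≤ ((n + 2 : ℕ) : ℝ) := by exact_mod_cast (show 2 ≤ n + 2 by omega)
    set M : ℝ := ((n + 2 : ℕ) : ℝ) with hM
    have hM1 : 0 < M - 1 := by linarith
    have hMpos : 0 < M := by linarith
    have hCM : 8 < C * M := by
      have h1 : 8 / C < M := hn.trans_le (by rw [hM]; exact_mod_cast Nat.le_add_right n 2)
      have := (div_lt_iff₀ hC).mp h1
      linarith [this]
    have hVpos : 0 < boolVariance p := by
      rw [hVar]; exact div_pos (mul_pos two_pos hM1) (pow_pos hMpos 3)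
    obtain ⟨i, hi⟩ := h (n + 2) 1 p le_rfl hPB hLap hVpos
    change C * boolVariance p ^ a / ((1 : ℕ) : ℝ) ^ b ≤ influence i p at hi
    rw [Nat.cast_one, one_pow, div_one, hVar, hInf] at hi
    have hv1 : 2 * (M - 1) / M ^ 3 ≤ 1 := by
      rw [div_le_one (pow_pos hMpos 3)]
      have hMM : 4 ≤ M * M := by nlinarith
      have h4 : 4 * M ≤ M ^ 3 := by
        rw [pow_succ, pow_two]; exact mul_le_mul_of_nonneg_right hMM hMpos.le
      linarith
    have hpow : 2 * (M - 1) / M ^ 3 ≤ (2 * (M - 1) / M ^ 3) ^ a := by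
      interval_cases a
      · rw [pow_zero]; exact hv1
      · rw [pow_one]
    have hle : C * (2 * (M - 1) / M ^ 3) ≤ 16 * (M - 1) / M ^ 4 :=
      (mul_le_mul_of_nonneg_left hpow hC.le).trans hi
    rw [← mul_div_assoc, div_le_div_iff₀ (pow_pos hMpos 3) (pow_pos hMpos 4)] at hle
    have e : C * (2 * (M - 1)) * M ^ 4 - 16 * (M - 1) * M ^ 3 = (2 * C * M - 16) * ((M - 1) * M ^ 3) := by
      ring
    have hprod : 0 < (2 * C * M - 16) * ((M - 1) * M ^ 3) :=
      mul_pos (by linarith) (mul_pos hM1 (pow_pos hMpos 3))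
    linarith [hle, hprod, e]
  · -- `b ≥ 1`: the iterated address family at the fixed variance `1/4`
    by_contra hb
    push Not at hb
    have hb0 : b = 0 := by omega
    subst hb0
    -- an order `T = 2^{k+1}` with `2^{k+1} > 4^a / C`
    obtain ⟨k, hk⟩ := pow_unbounded_of_one_lt ((4 : ℝ) ^ a / C) (by norm_num : (1 : ℝ) < 2)
    obtain ⟨N, P, hPB, hLap, hVar, hInf⟩ := AddrWitness.exists_counterexample k
    have hVpos : 0 < boolVariance P := by rw [hVar]; norm_num
    obtain ⟨i, hi⟩ := h N (2 ^ (k + 1)) P Nat.one_le_two_pow hPB hLap hVpos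
    change C * boolVariance P ^ a / (((2 ^ (k + 1) : ℕ) : ℝ)) ^ 0 ≤ influence i P at hi
    rw [pow_zero, div_one, hVar, hInf] at hi
    -- hi : C (1/4)^a ≤ 1/2^{k+1} ≤ 1/2^k < C/4^a
    have h4 : (0 : ℝ) < (4 : ℝ) ^ a := by positivity
    have h2k : (0 : ℝ) < (2 : ℝ) ^ k := by positivity
    have hCa : (4 : ℝ) ^ a / C * (1 / (2 : ℝ) ^ (k + 1)) < 1 := by
      have hmono : 1 / (2 : ℝ) ^ (k + 1) ≤ 1 / (2 : ℝ) ^ k :=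
        one_div_le_one_div_of_le h2k (pow_le_pow_right₀ (by norm_num) (Nat.le_succ k))
      calc (4 : ℝ) ^ a / C * (1 / (2 : ℝ) ^ (k + 1)) ≤ (4 : ℝ) ^ a / C * (1 / (2 : ℝ) ^ k) :=
            mul_le_mul_of_nonneg_left hmono (by positivity)
        _ < (2 : ℝ) ^ k * (1 / (2 : ℝ) ^ k) := mul_lt_mul_of_pos_right hk (by positivity)
        _ = 1 := by field_simp
    have hone : (1 : ℝ) ≤ (4 : ℝ) ^ a / C * (1 / (2 : ℝ) ^ (k + 1)) := by
      have := mul_le_mul_of_nonneg_left hi (le_of_lt (div_pos h4 hC))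
      have hlhs : (4 : ℝ) ^ a / C * (C * (1 / 4) ^ a) = 1 := by
        rw [one_div_pow]; field_simp
      linarith [hlhs]
    linarith

/-- **The degree-free edge is inadmissible for every variance exponent**: no law `Infᵢ ≥ C·Var^a` (no loss in
`T`) holds on the top-homogeneous sandwich class, whatever `a : ℕ` — the `b = 0` edge of
`homogeneousRung_exponent_corner`; the refuted item `HomogeneousPBAA` (stmt-QuantumAdvantage-15241) was `a = 2`.
[cite: EscuderoGutierrez2023, Thm. 1.6, Cor. 1.7] -/
theorem homogeneousRung_degreeFree_inadmissible (a : ℕ) :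
    ¬ ∃ C : ℝ, 0 < C ∧ ∀ (N T : ℕ) (p : MvPolynomial (Fin N) ℝ),
      let ev : MvPolynomial (Fin N) ℝ → (Fin N → Bool) → ℝ :=
        fun f x => MvPolynomial.eval (fun k => if x k then (1 : ℝ) else 0) f
      let avg : ((Fin N → Bool) → ℝ) → ℝ := fun g => (∑ x : Fin N → Bool, g x) / (2 : ℝ) ^ N
      1 ≤ T →
      (∃ (m : ℕ) (q r : Fin m → MvPolynomial (Fin N) ℝ),
          (∀ j, (q j).totalDegree ≤ T ∧ (r j).totalDegree ≤ T) ∧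
            ∀ x : Fin N → Bool, ev p x = ∑ j, ev (q j) x ^ 2 ∧ 1 - ev p x = ∑ j, ev (r j) x ^ 2) →
      (∀ x : Fin N → Bool, ∑ i : Fin N, (ev p x - ev p (Function.update x i (!x i))) =
          4 * (T : ℝ) * (ev p x - avg (ev p))) →
      0 < (avg fun x => (ev p x - avg (ev p)) ^ 2) →
      ∃ i : Fin N, C * (avg fun x => (ev p x - avg (ev p)) ^ 2) ^ a ≤
        (avg fun x => (ev p x - ev p (Function.update x i (!x i))) ^ 2) := by
  rintro ⟨C, hC, h⟩
  have h' := homogeneousRung_exponent_corner a 0 hC (fun N T p hT hPB hLap hV => by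
    obtain ⟨i, hi⟩ := h N T p hT hPB hLap hV
    exact ⟨i, by rw [pow_zero, div_one]; exact hi⟩)
  omega

end Summit.QuantumAdvantage.QuantumAdvantage.Theorems.SosSandwich
end
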